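import Summits.AtomisticToContinuum.Crystallization.Theorems.ChessboardParticlePlanesPeriodicWindowsHcLayerSumMono
import Summits.AtomisticToContinuum.Crystallization.Theorems.ChessboardParticlePlanesPeriodicWindowsOffsetLayerSymmetry
import Summits.AtomisticToContinuum.Crystallization.Theorems.ChessboardParticlePlanesPeriodicWindowsGapSqueezeCompetitor2

/-!
# Crux `PeriodicWindows` (stmt-AtomisticToContinuum-3240), line `dense-laminar-hull` — stub HC, helper `hc_farPair`:
# the far-pair bound of the combined competitor

Write `Φ(a, H, θ) = ∑'_{(i,j) ∈ ℤ²} V_LJ ‖i v₁(a) + j v₂(a) + θ + H e₃‖` for the interaction of a point with a full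
triangular layer at height `H` and horizontal offset `θ` (inline, no definition). For `a ≥ 7/10`, heights
`1 ≤ |H'| ≤ |H|`, a horizontal offset `Θ` and a competitor offset `W = s b + i v₁ + j v₂` in a symmetric class
(`s ∈ {0, ±1}`, `b = barlowOffset a`), if the quadratic certificate
`|Φ(a, H', w + ξ) - Φ(a, H', w)| ≤ h ‖ξ‖²` holds at `w ∈ {0, b, -b}` for horizontal `ξ` with `‖ξ‖ ≤ 2a` (`h ≥ 0`), then
`Φ(a, H, Θ) - Φ(a, H', W) ≥ -h ‖Θ - W‖²`.

Route: (1) compression only helps, `Φ(a, H, Θ) ≥ Φ(a, H', Θ)` (`hc_layerSum_mono`; all distances are `≥ |H'| ≥ 1` by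
Pythagoras); (2) nearest-lattice reduction of `ξ = Θ - W` to `ξ₀ = ξ - (i' v₁ + j' v₂)` with `‖ξ₀‖ ≤ ‖ξ‖` and
`‖ξ₀‖ ≤ 2a` (`gsc_cover`); (3) lattice translations do not change `Φ` (`gs_offsetLayer_translate`), so
`Φ(H', Θ) = Φ(H', s b + ξ₀)` and `Φ(H', W) = Φ(H', s b)`; (4) the certificate at `w = s b`. All elementary. [folklore]
-/

noncomputable section

namespace Summit.AtomisticToContinuum.Crystallization.Theorems.PeriodicWindowsDenseLaminarHull

open Literature.MathematicalPhysics.StatisticalMechanics Filter Metric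
open scoped BigOperators

/-- The Barlow offset `b(a)` is horizontal. [folklore] -/
theorem hcf_barlowOffset_two (a : ℝ) : (barlowOffset a) 2 = 0 := by
  simp [barlowOffset]

/-- **Distances to a far layer are at least `1`**: for horizontal `θ` and `|H| ≥ 1`, every point
`i v₁ + j v₂ + θ + H e₃` has norm `≥ 1` (Pythagoras: the norm is at least `|H|`). [folklore] -/
theorem hcf_one_le_norm {a : ℝ} (ha : a ≠ 0) (θ : EuclideanSpace ℝ (Fin 3)) (hθ : θ 2 = 0) {H : ℝ}
    (hH : 1 ≤ |H|) (i j : ℝ) :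
    1 ≤ ‖i • triangularVec₁ a + j • triangularVec₂ a + θ + H • layerNormal 1‖ := by
  have h2 := (old_norm_sq_horiz ha θ hθ i j).1
  have e := gsc_norm_sq_horiz_add _ h2 H
  have hsq : 1 ≤ H ^ 2 := (one_le_sq_iff_one_le_abs H).2 hH
  have h1 : 1 ≤ ‖i • triangularVec₁ a + j • triangularVec₂ a + θ + H • layerNormal 1‖ ^ 2 := by
    rw [e]; nlinarith [sq_nonneg ‖i • triangularVec₁ a + j • triangularVec₂ a + θ‖]
  have := (one_le_sq_iff_one_le_abs _).1 h1
  rwa [abs_of_nonneg (norm_nonneg _)] at this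

/-- **Nearest-lattice reduction**: every horizontal `ξ` has a lattice translate `ξ - (i v₁ + j v₂)` of norm at most
`min ‖ξ‖ (2a)` (`(i, j) = (0, 0)` if `‖ξ‖ ≤ 2a`, else `gsc_cover`). [folklore] -/
theorem hcf_reduce {a : ℝ} (ha : 0 < a) (ξ : EuclideanSpace ℝ (Fin 3)) (hξ : ξ 2 = 0) :
    ∃ i j : ℤ, ‖ξ - ((i : ℝ) • triangularVec₁ a + (j : ℝ) • triangularVec₂ a)‖ ≤ 2 * a ∧
      ‖ξ - ((i : ℝ) • triangularVec₁ a + (j : ℝ) • triangularVec₂ a)‖ ≤ ‖ξ‖ := by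
  by_cases hle : ‖ξ‖ ≤ 2 * a
  · exact ⟨0, 0, by simpa using hle, by simp⟩
  · obtain ⟨i, j, hij⟩ := gsc_cover ha ξ hξ
    exact ⟨i, j, hij, hij.trans (not_le.1 hle).le⟩

/-- **Stub HC helper `hc_farPair`** (far-pair bound of the combined competitor, parametric in the quadratic constant
`h ≥ 0`): for `a ≥ 7/10`, `1 ≤ |H'| ≤ |H|`, a horizontal `Θ` and `W = s b + i v₁ + j v₂` (`s ∈ {0, ±1}`), the quadratic
certificate `|Φ(H', w + ξ) - Φ(H', w)| ≤ h ‖ξ‖²` at `w ∈ {0, b, -b}`, `‖ξ‖ ≤ 2a`, gives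
`Φ(H, Θ) - Φ(H', W) ≥ -h ‖Θ - W‖²` (compression only helps, nearest-lattice reduction, lattice-translation
invariance). [folklore] -/
theorem hc_farPair : ∀ a : ℝ, (7 : ℝ) / 10 ≤ a → ∀ (H H' h : ℝ), 0 ≤ h → 1 ≤ |H'| → |H'| ≤ |H| →
    (∀ (w ξ : EuclideanSpace ℝ (Fin 3)), (w = 0 ∨ w = barlowOffset a ∨ w = -barlowOffset a) → ξ 2 = 0 → ‖ξ‖ ≤ 2 * a →
      |(∑' ij : ℤ × ℤ, lennardJones ‖((ij.1 : ℝ)) • triangularVec₁ a + ((ij.2 : ℝ)) • triangularVec₂ a + (w + ξ) +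
          H' • layerNormal 1‖) -
        (∑' ij : ℤ × ℤ, lennardJones ‖((ij.1 : ℝ)) • triangularVec₁ a + ((ij.2 : ℝ)) • triangularVec₂ a + w +
          H' • layerNormal 1‖)| ≤ h * ‖ξ‖ ^ 2) →
    ∀ (Θ W : EuclideanSpace ℝ (Fin 3)), Θ 2 = 0 →
    (∃ s i j : ℤ, (s = 0 ∨ s = 1 ∨ s = -1) ∧ W = (s : ℝ) • barlowOffset a + (i : ℝ) • triangularVec₁ a + (j : ℝ) • triangularVec₂ a) →
    -(h * ‖Θ - W‖ ^ 2) ≤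
      (∑' ij : ℤ × ℤ, lennardJones ‖((ij.1 : ℝ)) • triangularVec₁ a + ((ij.2 : ℝ)) • triangularVec₂ a + Θ + H • layerNormal 1‖) -
      (∑' ij : ℤ × ℤ, lennardJones ‖((ij.1 : ℝ)) • triangularVec₁ a + ((ij.2 : ℝ)) • triangularVec₂ a + W + H' • layerNormal 1‖) := by
  intro a ha H H' h hh hH' hHH' hyp Θ W hΘ hW
  obtain ⟨s, i, j, hs, rfl⟩ := hW
  have ha0 : 0 < a := by linarith
  have hb2 := hcf_barlowOffset_two a
  -- (1) compression only helps
  have step1 :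
      (∑' ij : ℤ × ℤ, lennardJones ‖((ij.1 : ℝ)) • triangularVec₁ a + ((ij.2 : ℝ)) • triangularVec₂ a + Θ +
          H' • layerNormal 1‖) ≤
        ∑' ij : ℤ × ℤ, lennardJones ‖((ij.1 : ℝ)) • triangularVec₁ a + ((ij.2 : ℝ)) • triangularVec₂ a + Θ +
          H • layerNormal 1‖ :=
    hc_layerSum_mono a ha Θ hΘ H' H (le_trans (by norm_num) hH') hHH'
      (fun ij => hcf_one_le_norm ha0.ne' Θ hΘ hH' _ _)
  -- (2) nearest-lattice reduction of `ξ = Θ - W`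
  have hξ2 : (Θ - ((s : ℝ) • barlowOffset a + (i : ℝ) • triangularVec₁ a + (j : ℝ) • triangularVec₂ a)) 2 = 0 := by
    simp only [PiLp.sub_apply, PiLp.add_apply, PiLp.smul_apply, hΘ, hb2, gsc_triangularVec₁_two,
      gsc_triangularVec₂_two, smul_eq_mul, mul_zero, add_zero, sub_zero]
  obtain ⟨i', j', h2a, hle⟩ := hcf_reduce ha0 _ hξ2
  obtain ⟨ξ₀, hξ₀⟩ : ∃ ξ₀ : EuclideanSpace ℝ (Fin 3),
      ξ₀ = Θ - ((s : ℝ) • barlowOffset a + (i : ℝ) • triangularVec₁ a + (j : ℝ) • triangularVec₂ a) -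
        ((i' : ℝ) • triangularVec₁ a + (j' : ℝ) • triangularVec₂ a) := ⟨_, rfl⟩
  rw [← hξ₀] at h2a hle
  have hξ₀2 : ξ₀ 2 = 0 := by
    rw [hξ₀, PiLp.sub_apply, hξ2, PiLp.add_apply, PiLp.smul_apply, PiLp.smul_apply, gsc_triangularVec₁_two,
      gsc_triangularVec₂_two]
    simp
  -- the base point `w = s b ∈ {0, b, -b}`
  have hw : (s : ℝ) • barlowOffset a = 0 ∨ (s : ℝ) • barlowOffset a = barlowOffset a ∨
      (s : ℝ) • barlowOffset a = -barlowOffset a := by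
    rcases hs with rfl | rfl | rfl <;> simp
  -- (3) lattice translations do not change `Φ`
  have hΘeq : Θ = ((s : ℝ) • barlowOffset a + ξ₀) +
      (((i + i' : ℤ) : ℝ) • triangularVec₁ a + ((j + j' : ℤ) : ℝ) • triangularVec₂ a) := by
    rw [hξ₀]; push_cast; module
  have step2 :
      (∑' ij : ℤ × ℤ, lennardJones ‖((ij.1 : ℝ)) • triangularVec₁ a + ((ij.2 : ℝ)) • triangularVec₂ a + Θ +
          H' • layerNormal 1‖) =
        ∑' ij : ℤ × ℤ, lennardJones ‖((ij.1 : ℝ)) • triangularVec₁ a + ((ij.2 : ℝ)) • triangularVec₂ a +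
          ((s : ℝ) • barlowOffset a + ξ₀) + H' • layerNormal 1‖ := by
    have := gs_offsetLayer_translate lennardJones a H' ((s : ℝ) • barlowOffset a + ξ₀) (i + i') (j + j')
    rwa [← hΘeq] at this
  have step3 :
      (∑' ij : ℤ × ℤ, lennardJones ‖((ij.1 : ℝ)) • triangularVec₁ a + ((ij.2 : ℝ)) • triangularVec₂ a +
          ((s : ℝ) • barlowOffset a + (i : ℝ) • triangularVec₁ a + (j : ℝ) • triangularVec₂ a) + H' • layerNormal 1‖) =
        ∑' ij : ℤ × ℤ, lennardJones ‖((ij.1 : ℝ)) • triangularVec₁ a + ((ij.2 : ℝ)) • triangularVec₂ a +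
          (s : ℝ) • barlowOffset a + H' • layerNormal 1‖ := by
    rw [add_assoc ((s : ℝ) • barlowOffset a)]
    exact gs_offsetLayer_translate lennardJones a H' ((s : ℝ) • barlowOffset a) i j
  -- (4) the quadratic certificate at `w = s b` with the reduced `ξ₀`
  have step4 := (abs_le.1 (hyp ((s : ℝ) • barlowOffset a) ξ₀ hw hξ₀2 h2a)).1
  have h5 : h * ‖ξ₀‖ ^ 2 ≤
      h * ‖Θ - ((s : ℝ) • barlowOffset a + (i : ℝ) • triangularVec₁ a + (j : ℝ) • triangularVec₂ a)‖ ^ 2 :=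
    mul_le_mul_of_nonneg_left (pow_le_pow_left₀ (norm_nonneg _) hle 2) hh
  rw [step3]
  linarith [step1, step2, step4, h5]

end Summit.AtomisticToContinuum.Crystallization.Theorems.PeriodicWindowsDenseLaminarHull

end
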